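import Literature.NumberTheory.QuadraticFields.KroneckerCharacterFourProofs
import Mathlib.NumberTheory.Padics.PadicNumbers
import HarnessLib

/-!
# Crux `PrintCFram.BottomClassIndexLawFiveLe` (stmt-BirchSwinnertonDyer-20372), line `eisenstein-resource-bdp-line`:
# the KRIZ–LI BINDERS CLASS-LEVEL, part K-odd — the `ℚ_p`-valued Kronecker character of an ODD fundamental discriminant,
# `a ↦ J(a | |D|)`, EXISTS, is QUADRATIC and is PRIMITIVE
# (cell `bsd-print-cfram`, width seat `bsd-line-cfram-p1-w3` g2; THEOREMS ONLY, `--supports` 20372; BSD is not proved by any of this)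

HONEST FRAMING. Nothing here is a statement about BSD or about any curve. The «(regular) Kriz–Li datum» hypothesis of the
line's skeleton (v6 `Cruxes/BottomClassIndexLawFiveLe/Lines/eisenstein_resource_bdp_line.lean`, and the LEAD's regular-locus /
Kriz–Li-locus theorems `…RegularLocusBSDp`, `…KrizLiLocusKolyvagin`) carries Kriz–Li 2019 Thm. 1.20's character data as FIVE
binder lines: a PRIMITIVE `ψ : DirichletCharacter ℚ_[p] f`, a Teichmüller `ω`, the trace form `hss`, and hypotheses (1), (3).
On the crux's class (`W` CM, `p ≥ 5` CM-ramified) these are CONSTRUCTIBLE: `ψ = χ_D · ω^{(p+1)/4}` (or `· ω^{(3p−1)/4}`),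
with `χ_D` the Kronecker character of the member's twisting discriminant `D`, read `p`-ADICALLY. Cell `bsd-cm`'s Route U did
this at `p = 7` member by member (`RouteUPrimePsi`, `RouteUJacobiPsi`, `RouteUKroneckerEven`, all `ℚ_7`-valued); the tree's
general Kronecker characters (`QuadraticFields.jacobiChar`, `LFunctions.KroneckerCharacter.kroneckerChar`) are `ℂ`-valued.
This file (odd `D`) and its companion `…KrizLiBindersKroneckerEven` (even `D = 4m`) are the `ℚ_p`-valued port, for every
prime `p`, stated — as Route U does — by EXISTENCE theorems characterised by VALUES (no definition is introduced):

* `exists_jacobiCharPadic` — for `q ≠ 0` a character `χ` mod `q` with `χ(a) = J(a | q)` for every `a : ℕ`;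
* `isQuadratic_of_forall_eq_jacobiSym`, `apply_natCast_eq_zero_iff_…`, `apply_natCast_sq_eq_one_…`;
* **`isPrimitive_of_forall_eq_jacobiSym`** — `q` odd squarefree ⟹ conductor `q`; `ne_one_of_forall_eq_jacobiSym`.

This is exactly the shape in which the tree's twisting formula `LFunction_quadraticTwist_apply_of_emod_four_eq_one` delivers
`a_ℓ(E^{(D)}) = J(ℓ | |D|)·a_ℓ(E)` (`D ≡ 1 (mod 4)`) — consumed by part W of this series. Proofs: adapted from
`Literature/NumberTheory/QuadraticFields/JacobiCharacter.lean` / `JacobiCharacterPrimitiveProofs.lean` (ℂ-valued).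
beyond-print theorem: NO.

References: [MontgomeryVaughan2007] Thm. 9.13; [Cox2013] §1.C Lemma 1.14; [KrizLi2019] §2 (pp. 11–12, conventions on
primitive characters); [Washington1997] Ch. 3.
-/

noncomputable section

-- summit-side namespace `Summit.BirchSwinnertonDyer.BirchSwinnertonDyer.…` (single-conjunct summit, D-0017 layout)
set_option linter.dupNamespace false

open scoped Classical NumberTheorySymbols
open Literature.NumberTheory.QuadraticFields

namespace Summit.BirchSwinnertonDyer.BirchSwinnertonDyer.Theorems.PrintCFram.KrizLiBinders

variable {p : ℕ} [Fact p.Prime]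

/-! ## Odd discriminants: `a ↦ J(a | q)` as a `ℚ_p`-valued Dirichlet character mod `q` -/

/-- **The Jacobi symbol `a ↦ J(a | q)` as a `ℚ_p`-valued Dirichlet character modulo `q`** (`q ≠ 0`): there is a character
`χ` mod `q` with `χ(a) = J(a | q)` for every `a : ℕ` (well defined by `q`-periodicity `jacobiSym.mod_left`; multiplicative
by `jacobiSym.mul_left`; zero off the units by `jacobiSym.eq_zero_iff_not_coprime`).
-- adapted from Literature/NumberTheory/QuadraticFields/JacobiCharacter.lean (`jacobiChar`, ℂ-valued)
[cite: Cox2013, §1.C Lemma 1.14 (proof, (1.15)–(1.16))] -/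
theorem exists_jacobiCharPadic (q : ℕ) [NeZero q] :
    ∃ χ : DirichletCharacter ℚ_[p] q, ∀ a : ℕ, χ (a : ZMod q) = (J((a : ℤ) | q) : ℚ_[p]) := by
  set f : ZMod q → ℚ_[p] := fun a => (J((a.val : ℤ) | q) : ℚ_[p]) with hf
  refine ⟨{ toFun := f, map_one' := ?_, map_mul' := ?_, map_nonunit' := ?_ }, ?_⟩
  · simp only [hf]
    rw [ZMod.val_one_eq_one_mod, jacobiSym_natCast_mod, Nat.cast_one, jacobiSym.one_left, Int.cast_one]
  · intro a b
    simp only [hf]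
    rw [ZMod.val_mul, jacobiSym_natCast_mod, Nat.cast_mul, jacobiSym.mul_left, Int.cast_mul]
  · intro a ha
    simp only [hf]
    have hval : ¬ a.val.Coprime q := fun h => ha (by
      rw [← ZMod.natCast_zmod_val a]
      exact (ZMod.isUnit_iff_coprime a.val q).mpr h)
    have h0 : J((a.val : ℤ) | q) = 0 := by
      rw [jacobiSym.eq_zero_iff_not_coprime, Int.gcd_natCast_natCast]
      exact hval
    rw [h0, Int.cast_zero]
  · intro a
    show f (a : ZMod q) = _
    simp only [hf]
    rw [ZMod.val_natCast, jacobiSym_natCast_mod]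

section OddValues

variable {q : ℕ} [NeZero q] {χ : DirichletCharacter ℚ_[p] q}
  (hχ : ∀ a : ℕ, χ (a : ZMod q) = (J((a : ℤ) | q) : ℚ_[p]))
include hχ

/-- Values on `ZMod q`: `χ(a) = J(a.val | q)`. [folklore] -/
theorem apply_eq_jacobiSym_val (a : ZMod q) : χ a = (J((a.val : ℤ) | q) : ℚ_[p]) := by
  rw [← hχ a.val, ZMod.natCast_zmod_val]

/-- A character with the Jacobi values is quadratic (values in `{0, 1, −1}`). [folklore] -/
theorem isQuadratic_of_forall_eq_jacobiSym : χ.IsQuadratic := by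
  intro a
  rw [apply_eq_jacobiSym_val hχ]
  rcases jacobiSym.trichotomy (a.val : ℤ) q with h | h | h <;> rw [h] <;> norm_num

/-- `χ(a) = 0 ↔ (a, q) ≠ 1`. [folklore] -/
theorem apply_natCast_eq_zero_iff_of_forall_eq_jacobiSym (a : ℕ) : χ (a : ZMod q) = 0 ↔ ¬ a.Coprime q := by
  rw [hχ a, Int.cast_eq_zero, jacobiSym.eq_zero_iff_not_coprime, Int.gcd_natCast_natCast]

omit [NeZero q] in
/-- `χ(a)² = 1` for `(a, q) = 1`. [folklore] -/
theorem apply_natCast_sq_eq_one_of_forall_eq_jacobiSym {a : ℕ} (ha : a.Coprime q) : χ (a : ZMod q) ^ 2 = 1 := by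
  rw [hχ a]
  have hg : (a : ℤ).gcd q = 1 := by rw [Int.gcd_natCast_natCast]; exact ha
  rcases jacobiSym.eq_one_or_neg_one hg with h | h <;> rw [h] <;> norm_num

/-- **A `ℚ_p`-valued character with the Jacobi values `J(· | q)` is PRIMITIVE for `q` odd and squarefree** (conductor `q`:
the Kronecker character of an odd fundamental discriminant `D`, `q = |D|`). If `χ` factored through its conductor
`c ≠ q`, pick a prime `ℓ ∣ q/c`, a non-residue `a` mod `ℓ` and `n ≡ a (mod ℓ)`, `n ≡ 1 (mod q/ℓ)`: `n` is a unit mod `q`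
that is `1` mod `c`, yet `J(n | q) = (a/ℓ)·J(1 | q/ℓ) = −1`.
-- adapted from Literature/NumberTheory/QuadraticFields/JacobiCharacterPrimitiveProofs.lean (`isPrimitive_jacobiChar`, ℂ-valued)
[cite: MontgomeryVaughan2007, Theorem 9.13] [cite: Cox2013, §1.C Lemma 1.14] -/
theorem isPrimitive_of_forall_eq_jacobiSym (hodd : Odd q) (hsq : Squarefree q) : χ.IsPrimitive := by
  rw [DirichletCharacter.isPrimitive_def]
  set c := χ.conductor with hc
  have hcdvd : c ∣ q := DirichletCharacter.conductor_dvd_level _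
  have hft : χ.FactorsThrough c := DirichletCharacter.factorsThrough_conductor _
  by_contra hne
  -- a prime `ℓ ∣ q` not dividing `c`
  obtain ⟨k, hk⟩ := hcdvd
  have hk1 : k ≠ 1 := fun h ↦ hne (by rw [hk, h, mul_one])
  obtain ⟨ℓ, hℓ, hℓk⟩ := Nat.exists_prime_and_dvd hk1
  have hℓq : ℓ ∣ q := hk ▸ (hℓk.mul_left c)
  have hℓc : ¬ ℓ ∣ c := by
    intro h
    have h2 : ℓ * ℓ ∣ q := hk ▸ mul_dvd_mul h hℓk
    exact hℓ.one_lt.ne' (Nat.isUnit_iff.mp (hsq ℓ h2))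
  -- the cofactor `m = q / ℓ` is coprime to `ℓ` and divisible by `c`
  set m := q / ℓ with hm
  have hqm : q = ℓ * m := (Nat.mul_div_cancel' hℓq).symm
  have hcop : ℓ.Coprime m :=
    Literature.NumberTheory.LFunctions.PrimitiveQuadratic.coprime_div_of_squarefree hsq hℓ hℓq
  have hℓ0 : ℓ ≠ 0 := hℓ.ne_zero
  have hm0 : m ≠ 0 := fun h ↦ NeZero.ne q (by rw [hqm, h, mul_zero])
  have hcm : c ∣ m :=
    (((Nat.Prime.coprime_iff_not_dvd hℓ).mpr hℓc).symm).dvd_of_dvd_mul_left (hqm ▸ ⟨k, hk⟩)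
  haveI := Fact.mk hℓ
  have hℓ2 : ℓ ≠ 2 := by
    rintro rfl
    exact (Nat.not_even_iff_odd.mpr hodd) (even_iff_two_dvd.mpr hℓq)
  -- a non-residue `a` mod `ℓ` and `n ≡ a (mod ℓ)`, `n ≡ 1 (mod m)`
  have hchar : ringChar (ZMod ℓ) ≠ 2 := by rwa [ZMod.ringChar_zmod_n]
  obtain ⟨a, ha⟩ := quadraticChar_exists_neg_one hchar
  have ha0 : a ≠ 0 := by
    rintro rfl
    rw [MulChar.map_zero] at ha
    norm_num at ha
  obtain ⟨n, hn1, hn2⟩ := Nat.chineseRemainder hcop a.val 1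
  have hnℓ : n % ℓ = a.val := by
    rw [show n % ℓ = a.val % ℓ from hn1, Nat.mod_eq_of_lt (ZMod.val_lt a)]
  have hJℓ : J((n : ℤ) | ℓ) = -1 := by
    rw [← jacobiSym_natCast_mod, hnℓ, ← jacobiSym.legendreSym.to_jacobiSym, legendreSym,
      Int.cast_natCast, ZMod.natCast_zmod_val]
    exact ha
  have hJm : J((n : ℤ) | m) = 1 := by
    rw [← jacobiSym_natCast_mod, show n % m = 1 % m from hn2, jacobiSym_natCast_mod, Nat.cast_one,
      jacobiSym.one_left]
  have hJ : χ (n : ZMod q) = -1 := by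
    rw [hχ n, hqm, jacobiSym.mul_right' (n : ℤ) hℓ0 hm0, hJℓ, hJm]
    norm_num
  -- `n` is a unit mod `q` mapping to `1` mod `c` ...
  have hnℓ' : n.Coprime ℓ := by
    refine ((Nat.Prime.coprime_iff_not_dvd hℓ).mpr fun h ↦ ha0 ?_).symm
    rw [← ZMod.val_eq_zero, ← hnℓ]
    exact Nat.mod_eq_zero_of_dvd h
  have hnm : n.Coprime m := (Nat.ModEq.gcd_eq hn2).trans (Nat.gcd_one_left m)
  have hnq : n.Coprime q := hqm ▸ Nat.Coprime.mul_right hnℓ' hnm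
  have hcq : c ∣ q := ⟨k, hk⟩
  have hker := (DirichletCharacter.factorsThrough_iff_ker_unitsMap hcq).mp hft
  have hx : ZMod.unitOfCoprime n hnq ∈ (ZMod.unitsMap hcq).ker := by
    rw [MonoidHom.mem_ker, ZMod.unitsMap_def, Units.ext_iff, Units.coe_map, MonoidHom.coe_coe,
      ZMod.castHom_apply, Units.val_one, ZMod.coe_unitOfCoprime, ZMod.cast_natCast hcq]
    have h := (ZMod.natCast_eq_natCast_iff n 1 c).mpr (Nat.ModEq.of_dvd hcm hn2)
    rwa [Nat.cast_one] at h
  -- ... so `χ(n) = 1`, contradicting `J(n | q) = -1`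
  have h1 := hker hx
  rw [MonoidHom.mem_ker, Units.ext_iff, MulChar.coe_toUnitHom, Units.val_one,
    ZMod.coe_unitOfCoprime, hJ] at h1
  norm_num at h1

/-- A primitive character of level `q ≠ 1` is non-trivial. [cite: Washington1997, Ch. 3 (conductor)] -/
theorem ne_one_of_forall_eq_jacobiSym (hodd : Odd q) (hsq : Squarefree q) (hq1 : q ≠ 1) : χ ≠ 1 := by
  intro h
  have hc : χ.conductor = q := isPrimitive_of_forall_eq_jacobiSym hχ hodd hsq
  rw [h, DirichletCharacter.conductor_one] at hc
  exact hq1 hc.symm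

end OddValues

end Summit.BirchSwinnertonDyer.BirchSwinnertonDyer.Theorems.PrintCFram.KrizLiBinders

end
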